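import Literature.Computability.Cryptography.OracleGames
import Literature.Computability.Complexity.OracleBPPAmplification
import Literature.Computability.Complexity.OracleClockFst
import Literature.Computability.Complexity.OracleComposition
import HarnessLib

/-!
# A PPT oracle adversary deciding a language with error below one half puts it in `BPP^A`

Layer `Literature/Computability/Cryptography`. Bridge between the two presentations of
probabilistic polynomial-time oracle computation in the tree: the ORACLE ADVERSARY of
`OracleGames.lean` (a deterministic transcript algorithm `OracleAlg.step` reading its coins from
the second field of its input, with polynomial coin and round budgets; output law
`OracleAdversary.outputPMF`) and the operator class `BPPRel O = bp (PRel O)` of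
`Complexity/Oracle.lean` (a witness language in `P^O` correct on `2/3` of the coin strings). For a
LANGUAGE oracle `A`:

* **`OracleAdversary.mem_BPPRel_of_acceptProb`** — if a PPT adversary `𝒜 : OracleAdversary Bool`
  with oracle `A` accepts (outputs `some true`) every `x ∈ L` with probability `≥ 1 − e` and every
  `x ∉ L` with probability `≤ e`, for some `e < 1/2`, then `L ∈ BPP^A`.

This is the routine identification "a probabilistic polynomial-time oracle machine with error
bounded away from `1/2`" = `BPP^A` (Arora–Barak 2009, Def. 7.1–7.3 and §7.4.1 with §3.4;
Bennett–Gill 1981, §1), carried out in the transcript model: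

1. *the witness machine* `𝒜.decider c = (𝒜.alg.capQ c false).clockFst 𝒜.fuel false` — the
   adversary's own algorithm, its queries capped at length `c(|w|)` (`OracleAlg.capQ`, so that
   the query-length clause of `PRel` holds by construction) and clocked by `fuel(|x|)` read off the
   first field `x` of its input `w = ⟨x, r⟩` (`OracleAlg.clockFst`, so that it halts against every
   oracle); polynomial time by `isPolyTime_capQ`, `isPolyTime_clockFst`; its language
   `𝒜.decLang A c` is in `P^A` (`decLang_mem_PRel`);
2. *the cap is inactive on genuine runs* — the queries of a polynomial-time step function fed
   one-bit answers have length polynomial in the input (`exists_cap`: output-length bound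
   `OracleAlg.IsPolyTime.exists_length_le` on a transcript of `i ≤ fuel` one-bit answers, whose
   code has length `6i + 2`), so on `w = ⟨x, r⟩` the witness machine accepts iff `𝒜` outputs
   `some true` within its budget (`boolPair_mem_decLang_iff`);
3. *probability* — the fraction of coin strings `r ∈ {0,1}^{coins(|x|)}` with a wrong verdict is
   `1 − Pr[accept]` on `x ∈ L` and `Pr[accept]` off `L` (`uniformProb` versus the push-forward
   `outputPMF`, `uniformProb_eq_toOuterMeasure`), so `L ∈ bpErr (P^A) e`
   (`mem_bpErr_PRel_of_acceptProb`);
4. *amplification* — `bpErr (P^A) e ⊆ BPP^A` for `e < 1/2` (`bpErr_PRel_subset_BPPRel`,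
   `OracleBPPAmplification.lean`).

Consumer: the re-routing of Aaronson–Chen 2017, Thm. 8.1 ("and consequently `BPP^O = BQP^O`")
through a decision form of their Lemma 8.2 (`Barriers/QuantumAdvantage/PPolyOraclesDecision.lean`).

## Design notes

* Only language oracles: with longer answers the transcript fed back to the step function, hence
  its queries, need not stay polynomially bounded (the adequacy caveat of `Oracle.lean`), and the
  bridge fails as stated.
* Acceptance is "output `some true` within `fuel(|x|)` rounds"; running out of rounds (`none`) or
  outputting `false` is rejection, matching `OracleAdversary.acceptProb`.

## References

* S. Arora, B. Barak, *Computational Complexity: A Modern Approach*, CUP 2009, Def. 7.1–7.3,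
  §7.4.1 (error bounded away from `1/2`), §3.4 (oracle machines) [AroraBarakCC2009].
* C. H. Bennett, J. Gill, SIAM J. Comput. 10 (1981) 96–113, §1 (`BPP^A`) [BennettGill1981].
* O. Goldreich, *Foundations of Cryptography I*, CUP 2001, §3.6 (probabilistic polynomial-time
  oracle machines) [Goldreich2001].
-/

noncomputable section

namespace Literature.Computability.Cryptography

open _root_.Computability Complexity Complexity.PRelSigma Complexity.OracleCompose Polynomial

namespace OracleAdversary

/-! ### Outer measure of a complement (PMF) -/

/-- `p(sᶜ) = 1 − p(s)` as real numbers, for the outer measure of a probability mass function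
(from `p(s) + p(sᶜ) = 1`; the `ℝ≥0∞` identity is also proved, for its own use, as
`Literature.Barriers.PneNP.toOuterMeasure_add_compl` in `Barriers/PneNP/LowDegreeCounterexamplesNoise.lean`
— refactor: hoist both next to `PMF.toOuterMeasure_apply`). [folklore] -/
theorem toReal_toOuterMeasure_compl {α : Type} (p : PMF α) (s : Set α) :
    (p.toOuterMeasure sᶜ).toReal = 1 - (p.toOuterMeasure s).toReal := by
  have h : p.toOuterMeasure s + p.toOuterMeasure sᶜ = 1 := by
    rw [PMF.toOuterMeasure_apply, PMF.toOuterMeasure_apply, ← ENNReal.tsum_add, ← p.tsum_coe]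
    exact tsum_congr fun x => Set.indicator_self_add_compl_apply s p x
  have hs : p.toOuterMeasure s ≠ ⊤ := ne_top_of_le_ne_top ENNReal.one_ne_top (h ▸ le_self_add)
  have hc : p.toOuterMeasure sᶜ ≠ ⊤ := ne_top_of_le_ne_top ENNReal.one_ne_top (h ▸ le_add_self)
  have h' := congrArg ENNReal.toReal h
  rw [ENNReal.toReal_add hs hc, ENNReal.toReal_one] at h'
  linarith

/-! ### The cap: queries of a PPT step function on one-bit transcripts are short -/

/-- Along a run against a language oracle every answer is one bit, so the code of the transcript
of the first `i` rounds has length `6i + 2`. [folklore] -/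
theorem length_encode_trans_ofLanguage {β : Type} (M : OracleAlg β) (A : Language Bool)
    (w : List Bool) (i : ℕ) :
    ((encodingList Bool).listBool.encode (trans M (Oracle.ofLanguage A) w i)).length = 6 * i + 2 := by
  rw [OracleComposition.length_listBool_encode, trans_eq_bitsTrans_answerBits]
  have hsum : ∀ u : List Bool, ((bitsTrans u).map fun a => 2 * a.length + 2).sum = 4 * u.length := by
    intro u
    induction u with
    | nil => rfl
    | cons b u ih =>
      rw [show bitsTrans (b :: u) = [b] :: bitsTrans u from rfl, List.map_cons, List.sum_cons, ih]
      simp; ring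
  rw [hsum, length_bitsTrans, length_answerBits]
  ring

/-- **A polynomial cap on the queries of a polynomial-time step function against a language
oracle**: there is a polynomial `c` (depending on the step function and a round budget `F`) such
that on every input `w`, within `n ≤ F(|w|)` rounds, every query has length `≤ c(|w|)` — the
output of the step function is polynomially long in its input `⟨w, transcript⟩`
(`OracleAlg.IsPolyTime.exists_length_le`), and the transcript code has length `6i + 2 ≤ 6F(|w|) + 2`.
[cite: AroraBarakCC2009, §3.4 with §1.2 (a machine writes at most one symbol per step)] -/
theorem exists_cap {β : Type} {eb : Encoding β Bool} {M : OracleAlg β} (hM : M.IsPolyTime eb)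
    (F : Polynomial ℕ) :
    ∃ c : Polynomial ℕ, ∀ (A : Language Bool) (w : List Bool) (n : ℕ), n ≤ F.eval w.length →
      ∀ y ∈ M.queries (Oracle.ofLanguage A) n w, y.length ≤ c.eval w.length := by
  obtain ⟨R, hR⟩ := hM.exists_length_le
  refine ⟨R.comp (2 * X + 6 * F + 4), fun A w n hn y hy => ?_⟩
  obtain ⟨i, hi, hall, rfl⟩ := exists_of_mem_queries M (Oracle.ofLanguage A) n w y hy
  obtain ⟨y', hy'⟩ := hall i le_rfl
  rw [qryOf_eq_of_step_eq hy']
  have h1 := hR w (trans M (Oracle.ofLanguage A) w i)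
  rw [hy'] at h1
  have hcode : (((encodingList Bool).sumBool eb).encode (Sum.inl y' : List Bool ⊕ β)).length =
      y'.length + 1 := by
    change (false :: y').length = _
    simp
  rw [hcode, length_boolPair, length_encode_trans_ofLanguage] at h1
  rw [eval_comp]
  have hmono := TM2Iter.eval_mono R
    (show 2 * w.length + 2 + (6 * i + 2) ≤ (2 * X + 6 * F + 4 : Polynomial ℕ).eval w.length by
      simp; omega)
  omega

/-! ### The witness machine and its language -/

variable (𝒜 : OracleAdversary Bool)

/-- **The witness machine**: the adversary's algorithm with queries capped at `c(|w|)` and the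
round budget `fuel(|x|)` enforced by a clock reading the first field `x` of the input `w = ⟨x, r⟩`;
past the budget, or on an over-long query, it rejects. [cite: AroraBarakCC2009, §3.4 with §1.4.1 (clocked simulation)] -/
def decider (c : Polynomial ℕ) : OracleAlg Bool :=
  (𝒜.alg.capQ c false).clockFst 𝒜.fuel false

/-- The witness machine is polynomial-time when the adversary is. [cite: AroraBarakCC2009, §3.4] -/
theorem isPolyTime_decider (h𝒜 : 𝒜.IsPPT encodingBoolBool) (c : Polynomial ℕ) :
    (𝒜.decider c).IsPolyTime encodingBoolBool :=
  OracleAlg.isPolyTime_clockFst (eb := encodingBoolBool)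
    (OracleAlg.isPolyTime_capQ (eb := encodingBoolBool) h𝒜 c false) 𝒜.fuel false

/-- The verdict of the capped algorithm within the budget read off the first field (`false` if it
does not halt in time). [folklore] -/
def decVerdict (A : Language Bool) (c : Polynomial ℕ) (w : List Bool) : Bool :=
  ((𝒜.alg.capQ c false).run (Oracle.ofLanguage A) (𝒜.fuel.eval (boolUnpair w).1.length) w).getD false

/-- **The witness language** `L' = {w | the witness machine accepts w}`. [cite: AroraBarakCC2009, Def. 7.3 (the witness language of BPP)] -/
def decLang (A : Language Bool) (c : Polynomial ℕ) : Language Bool :=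
  {w | 𝒜.decVerdict A c w = true}

/-- The round-and-query polynomial of the witness machine. [folklore] -/
def decBudget (c : Polynomial ℕ) : Polynomial ℕ := 𝒜.fuel + 1 + c

/-- **The witness machine decides the witness language** within `fuel(|w|) + 1 + c(|w|)` rounds,
on EVERY input and against the oracle `A` (`run_clockBy`: it outputs the verdict of the capped run
within `fuel(|x|)` rounds, `x` the first field, `|x| ≤ |w|`). [cite: AroraBarakCC2009, §3.4 with §1.4.1] -/
theorem run_decider (A : Language Bool) (c : Polynomial ℕ) (w : List Bool) :
    (𝒜.decider c).run (Oracle.ofLanguage A) ((𝒜.decBudget c).eval w.length) w =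
      some ((𝒜.decLang A c).boolIndicator w) := by
  have hfuel : 𝒜.fuel.eval (boolUnpair w).1.length < (𝒜.decBudget c).eval w.length := by
    have := TM2Iter.eval_mono 𝒜.fuel (length_boolUnpair_fst_le w)
    simp [decBudget]; omega
  rw [decider, OracleAlg.clockFst, OracleAlg.run_clockBy _ _ _ _ _ hfuel]
  congr 1
  change 𝒜.decVerdict A c w = _
  by_cases h : 𝒜.decVerdict A c w = true
  · rw [h, (Set.mem_iff_boolIndicator _ _).1 (show w ∈ 𝒜.decLang A c from h)]
  · rw [Bool.eq_false_iff.2 h, (Set.notMem_iff_boolIndicator _ _).1 (show w ∉ 𝒜.decLang A c from h)]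

/-- The queries of the witness machine obey the cap. [folklore] -/
theorem length_le_of_mem_queries_decider (A : Language Bool) (c : Polynomial ℕ) (w : List Bool)
    (n : ℕ) {y : List Bool} (hy : y ∈ (𝒜.decider c).queries (Oracle.ofLanguage A) n w) :
    y.length ≤ c.eval w.length :=
  OracleAlg.length_le_of_mem_queries_capQ _ c false _ w n
    (OracleAlg.queriesAux_clockBy_subset _ _ false _ w n [] y hy)

/-- **The witness language is in `P^A`** (machine `decider`, polynomial `decBudget`).
[cite: AroraBarakCC2009, Def. 7.3 with §3.4] [cite: BennettGill1981, §1] -/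
theorem decLang_mem_PRel (h𝒜 : 𝒜.IsPPT encodingBoolBool) (A : Language Bool) (c : Polynomial ℕ) :
    𝒜.decLang A c ∈ PRel (Oracle.ofLanguage A) :=
  ⟨𝒜.decider c, 𝒜.isPolyTime_decider h𝒜 c, 𝒜.decBudget c, fun w =>
    ⟨𝒜.run_decider A c w, fun y hy =>
      (𝒜.length_le_of_mem_queries_decider A c w _ hy).trans (by simp [decBudget])⟩⟩

/-- **On a genuine input the cap is inactive**: if `c` caps the queries of `𝒜.alg` within
`fuel(|w|)` rounds, then `⟨x, r⟩ ∈ L'` iff the adversary's deterministic run on `⟨x, r⟩` outputs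
`some true` within `fuel(|x|)` rounds. [cite: AroraBarakCC2009, Def. 7.1 with §3.4] -/
theorem boolPair_mem_decLang_iff (A : Language Bool) {c : Polynomial ℕ}
    (hc : ∀ (w : List Bool) (n : ℕ), n ≤ 𝒜.fuel.eval w.length →
      ∀ y ∈ 𝒜.alg.queries (Oracle.ofLanguage A) n w, y.length ≤ c.eval w.length)
    (x r : List Bool) :
    boolPair x r ∈ 𝒜.decLang A c ↔
      𝒜.alg.run (Oracle.ofLanguage A) (𝒜.fuel.eval x.length) (boolPair x r) = some true := by
  change 𝒜.decVerdict A c (boolPair x r) = true ↔ _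
  unfold decVerdict
  rw [boolUnpair_boolPair]
  dsimp only
  rw [(OracleAlg.run_capQ 𝒜.alg c false (Oracle.ofLanguage A) (boolPair x r) _
    (hc _ _ (TM2Iter.eval_mono 𝒜.fuel (by rw [length_boolPair]; omega)))).1]
  cases 𝒜.alg.run (Oracle.ofLanguage A) (𝒜.fuel.eval x.length) (boolPair x r) with
  | none => simp
  | some b => simp

/-! ### Probability: the wrong-verdict coin strings -/

/-- The acceptance probability of `𝒜` on `x` is the uniform measure of the coin strings on which
the deterministic run outputs `some true`. [cite: AroraBarakCC2009, Def. 7.1] -/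
theorem toReal_outputPMF_some_true (O : Oracle) (x : List Bool) :
    (𝒜.outputPMF O x (some true)).toReal =
      ((PMF.uniformOfFintype (List.Vector Bool (𝒜.coins.eval x.length))).toOuterMeasure
        {r | 𝒜.alg.run O (𝒜.fuel.eval x.length) (boolPair x r.toList) = some true}).toReal := by
  rw [outputPMF_eq_map, ← PMF.toOuterMeasure_apply_singleton, PMF.toOuterMeasure_map_apply]
  rfl

/-- **The wrong-verdict fraction on a member is the rejection probability.** With `c` capping
the genuine runs: on `x ∈ L` the coin strings `r ∈ {0,1}^{coins(|x|)}` with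
`¬(⟨x, r⟩ ∈ L' ↔ x ∈ L)` have uniform probability `1 − Pr[𝒜 accepts x]`.
[cite: AroraBarakCC2009, Def. 7.1–7.3] -/
theorem uniformProb_wrong_eq_of_mem (A : Language Bool) {L : Language Bool} {c : Polynomial ℕ}
    (hc : ∀ (w : List Bool) (n : ℕ), n ≤ 𝒜.fuel.eval w.length →
      ∀ y ∈ 𝒜.alg.queries (Oracle.ofLanguage A) n w, y.length ≤ c.eval w.length)
    {x : List Bool} (hx : x ∈ L) :
    uniformProb (𝒜.coins.eval x.length)
        {r : List Bool | ¬ (boolPair x r ∈ 𝒜.decLang A c ↔ x ∈ L)} =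
      1 - (𝒜.outputPMF (Oracle.ofLanguage A) x (some true)).toReal := by
  rw [uniformProb_eq_toOuterMeasure, toReal_outputPMF_some_true, ← toReal_toOuterMeasure_compl]
  congr 2
  ext r
  simp only [Set.mem_setOf_eq, 𝒜.boolPair_mem_decLang_iff A hc, hx, iff_true, Set.mem_compl_iff]

/-- **The wrong-verdict fraction off the language is the acceptance probability.**
[cite: AroraBarakCC2009, Def. 7.1–7.3] -/
theorem uniformProb_wrong_eq_of_not_mem (A : Language Bool) {L : Language Bool} {c : Polynomial ℕ}
    (hc : ∀ (w : List Bool) (n : ℕ), n ≤ 𝒜.fuel.eval w.length →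
      ∀ y ∈ 𝒜.alg.queries (Oracle.ofLanguage A) n w, y.length ≤ c.eval w.length)
    {x : List Bool} (hx : x ∉ L) :
    uniformProb (𝒜.coins.eval x.length)
        {r : List Bool | ¬ (boolPair x r ∈ 𝒜.decLang A c ↔ x ∈ L)} =
      (𝒜.outputPMF (Oracle.ofLanguage A) x (some true)).toReal := by
  rw [uniformProb_eq_toOuterMeasure, toReal_outputPMF_some_true]
  congr 2
  ext r
  simp only [Set.mem_setOf_eq, 𝒜.boolPair_mem_decLang_iff A hc, hx, iff_false, not_not]

/-! ### Main results -/

/-- **A PPT adversary with error `e` yields `L ∈ bpErr (P^A) e`**: if `𝒜` accepts every `x ∈ L`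
with probability `≥ 1 − e` and every `x ∉ L` with probability `≤ e`, then the witness language of
its capped, clocked algorithm (in `P^A`) errs on at most a fraction `e` of the coin strings.
[cite: AroraBarakCC2009, Def. 7.1–7.3 with §3.4] [cite: BennettGill1981, §1] -/
theorem mem_bpErr_PRel_of_acceptProb (h𝒜 : 𝒜.IsPPT encodingBoolBool) {A L : Language Bool} {e : ℝ}
    (hyes : ∀ x ∈ L, 1 - e ≤ (𝒜.outputPMF (Oracle.ofLanguage A) x (some true)).toReal)
    (hno : ∀ x ∉ L, (𝒜.outputPMF (Oracle.ofLanguage A) x (some true)).toReal ≤ e) :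
    L ∈ bpErr (PRel (Oracle.ofLanguage A)) e := by
  obtain ⟨c, hc⟩ := exists_cap (eb := encodingBoolBool) h𝒜 𝒜.fuel
  refine ⟨𝒜.decLang A c, 𝒜.decLang_mem_PRel h𝒜 A c, 𝒜.coins, fun x => ?_⟩
  by_cases hx : x ∈ L
  · rw [𝒜.uniformProb_wrong_eq_of_mem A (fun w n hn y hy => hc A w n hn y hy) hx]
    linarith [hyes x hx]
  · rw [𝒜.uniformProb_wrong_eq_of_not_mem A (fun w n hn y hy => hc A w n hn y hy) hx]
    exact hno x hx

/-- **A PPT oracle adversary deciding `L` with error below one half puts `L` in `BPP^A`.** For a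
language oracle `A`, a PPT `𝒜 : OracleAdversary Bool` and `e < 1/2`: if `Pr[𝒜^A(x) = 1] ≥ 1 − e`
for `x ∈ L` and `≤ e` for `x ∉ L`, then `L ∈ BPPRel (Oracle.ofLanguage A)`
(`mem_bpErr_PRel_of_acceptProb` and the amplification `bpErr_PRel_subset_BPPRel`).
[cite: AroraBarakCC2009, Def. 7.1–7.3 and §7.4.1, with §3.4] [cite: BennettGill1981, §1] -/
theorem mem_BPPRel_of_acceptProb (h𝒜 : 𝒜.IsPPT encodingBoolBool) {A L : Language Bool} {e : ℝ}
    (he : e < 1 / 2)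
    (hyes : ∀ x ∈ L, 1 - e ≤ (𝒜.outputPMF (Oracle.ofLanguage A) x (some true)).toReal)
    (hno : ∀ x ∉ L, (𝒜.outputPMF (Oracle.ofLanguage A) x (some true)).toReal ≤ e) :
    L ∈ BPPRel (Oracle.ofLanguage A) :=
  bpErr_PRel_subset_BPPRel A he (𝒜.mem_bpErr_PRel_of_acceptProb h𝒜 hyes hno)

/-- The same with the acceptance probabilities compared to a reference `π(x)` within `η`: if
`|Pr[𝒜^A accepts x] − π x| ≤ η`, `π x ≥ 2/3` on `L` and `π x ≤ 1/3` off `L`, and `η < 1/6`, then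
`L ∈ BPP^A` (error `1/3 + η < 1/2`). This is the form in which a classical simulation of a
`BQP^A` machine to within `η` in acceptance probability is consumed.
[cite: AroraBarakCC2009, §7.4.1 with §3.4] -/
theorem mem_BPPRel_of_abs_sub_le (h𝒜 : 𝒜.IsPPT encodingBoolBool) {A L : Language Bool}
    {π : List Bool → ℝ} {η : ℝ} (hη : η < 1 / 6)
    (happrox : ∀ x, |(𝒜.outputPMF (Oracle.ofLanguage A) x (some true)).toReal - π x| ≤ η)
    (hyes : ∀ x ∈ L, 2 / 3 ≤ π x) (hno : ∀ x ∉ L, π x ≤ 1 / 3) :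
    L ∈ BPPRel (Oracle.ofLanguage A) := by
  refine 𝒜.mem_BPPRel_of_acceptProb h𝒜 (e := 1 / 3 + η) (by linarith) (fun x hx => ?_) (fun x hx => ?_)
  · have h := happrox x
    rw [abs_le] at h
    linarith [hyes x hx]
  · have h := happrox x
    rw [abs_le] at h
    linarith [hno x hx]

end OracleAdversary

end Literature.Computability.Cryptography

end
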